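import Summits.ValiantsHypothesis.ValiantsHypothesis.Theorems.DefinabilityGapCoverCount
import Summits.ValiantsHypothesis.ValiantsHypothesis.Theorems.DefinabilityGapRandomPatterns
import HarnessLib

/-!
# DefinabilityGap — refined random witness patterns (Theorem A⁺): star-free patterns up to degree `≍ m² log`

Route `route-ValiantsHypothesis-DefinabilityGap` (decomp-valiant, lens 5: hardness–randomness / PIT axis), supporting
`KIPlantedHitting` (stmt-ValiantsHypothesis-23547) and the degree profile behind `KIAnnihilatorCHDefinable`
(stmt-ValiantsHypothesis-23444). Source: decomp-valiant lens-5 g16, NOTE-g16 §3.4–3.6 (refined Lemma 3, Theorem A⁺).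

MAIN THEOREM `kiPer_hits_of_refined`: for `m ≥ 3`, with `c = (m−2)/(m−1)`, if
`q(m)³ · (1 − c^{2t/m})^m < 1` then NO nonzero polynomial of total degree `≤ t` — of any size — annihilates `G_m`
(the crude `DefinabilityGapRandomPatterns.kiPer_hits_of_count` needed `q³(2t)^m < (m(m−1))^m`, which caps at
`t < m(m−1)/2`; the present condition reaches `t ≈ (m(m−1)/2)·ln(m/(3 ln q))`, in particular `t = q(m)` itself for large `m`).
Proof: a star at host `d` means the blocks of `supp κ₀` cover all `m` columns through the cells they share with `d`
(`≤ 2` each); `DefinabilityGapCoverCount.cover_count` bounds the number of such pattern choices by the coin product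
`(m!)^{q³} ∏_a φ(n_a)` with `Σ_a n_a ≤ 2·|supp κ₀|`; two AM–GM steps give `∏_a φ(n_a) ≤ (1 − c^{2s/m})^m`
(`prod_phi_le`); union over the `q³` hosts; then `kiPer_hits_of_starFree`. 0 sorry; VP ≠ VNP untouched.
-/

set_option linter.dupNamespace false

noncomputable section

open MvPolynomial
open Literature.Computability.AlgebraicComplexity Literature.Computability.MetaComplexity
open Summit.ValiantsHypothesis.ValiantsHypothesis.Theorems.DefinabilityGapAffineRung
open Summit.ValiantsHypothesis.ValiantsHypothesis.Theorems.DefinabilityGapAlienExclusion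
open Summit.ValiantsHypothesis.ValiantsHypothesis.Theorems.DefinabilityGapPatternCounts
open Summit.ValiantsHypothesis.ValiantsHypothesis.Theorems.DefinabilityGapRandomPatterns
open Summit.ValiantsHypothesis.ValiantsHypothesis.Theorems.DefinabilityGapBlockStep
open Summit.ValiantsHypothesis.ValiantsHypothesis.Theorems.DefinabilityGapCoverCount

namespace Summit.ValiantsHypothesis.ValiantsHypothesis.Theorems.DefinabilityGapRefinedPatterns

variable {m : ℕ}

/-! ## 1. Two AM–GM steps: `∏_a φ(n_a) ≤ (1 − c^{N/m})^m`, `N = Σ_a n_a` -/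

/-- `0 < c` for `m ≥ 3`. [this file] -/
theorem cbase_pos (hm : 3 ≤ m) : 0 < cbase m := by
  have h3 : (3 : ℝ) ≤ m := by exact_mod_cast hm
  unfold cbase
  exact div_pos (by linarith) (by linarith)

/-- The refined bound as a function of the total cell count `N`: `(1 − c^{N/m})^m`. [this file] -/
def coinBound (m N : ℕ) : ℝ := (1 - cbase m ^ ((N : ℝ) / m)) ^ m

/-- `coinBound` is monotone in `N`. [this file] -/
theorem coinBound_mono (hm : 3 ≤ m) {N N' : ℕ} (h : N ≤ N') : coinBound m N ≤ coinBound m N' := by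
  have h3 : (3 : ℝ) ≤ m := by exact_mod_cast hm
  have hm0 : (0 : ℝ) < m := by linarith
  unfold coinBound
  have hle : cbase m ^ ((N' : ℝ) / m) ≤ cbase m ^ ((N : ℝ) / m) :=
    Real.rpow_le_rpow_of_exponent_ge (cbase_pos hm) (cbase_le_one hm)
      (div_le_div_of_nonneg_right (by exact_mod_cast h) hm0.le)
  have h0 : 0 ≤ 1 - cbase m ^ ((N : ℝ) / m) :=
    sub_nonneg.2 (Real.rpow_le_one (cbase_nonneg hm) (cbase_le_one hm) (by positivity))
  exact pow_le_pow_left₀ h0 (by linarith) m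

/-- **Two AM–GM steps.** `∏_a φ(n_a) ≤ (1 − c^{(Σ_a n_a)/m})^m`. [this file] -/
theorem prod_phi_le (hm : 3 ≤ m) (n : Fin m → ℕ) : ∏ a, phi m (n a) ≤ coinBound m (∑ a, n a) := by
  have hmpos : 0 < m := by omega
  have hmR : (0 : ℝ) < m := by exact_mod_cast hmpos
  have hc0 := cbase_nonneg hm
  have hc1 := cbase_le_one hm
  set u : Fin m → ℝ := fun a => cbase m ^ n a with hu
  have hu0 : ∀ a, 0 ≤ u a := fun a => pow_nonneg hc0 _
  have hu1 : ∀ a, u a ≤ 1 := fun a => pow_le_one₀ hc0 hc1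
  -- AM–GM for `u`: `c^{N/m} = (∏ u)^{1/m} ≤ (Σ u)/m`
  have hA := Real.geom_mean_le_arith_mean (Finset.univ : Finset (Fin m)) (fun _ => (1 : ℝ)) u
    (fun _ _ => zero_le_one) (by simp [hmR]) (fun a _ => hu0 a)
  simp only [Real.rpow_one, one_mul, Finset.sum_const, Finset.card_univ, Fintype.card_fin, nsmul_eq_mul,
    mul_one] at hA
  have hprod : ∏ a, u a = cbase m ^ (∑ a, n a) := by
    simp only [hu]; exact Finset.prod_pow_eq_pow_sum _ _ _
  have hroot : (∏ a, u a) ^ ((m : ℝ)⁻¹) = cbase m ^ (((∑ a, n a : ℕ) : ℝ) / m) := by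
    rw [hprod, ← Real.rpow_natCast, ← Real.rpow_mul hc0, div_eq_mul_inv]
  rw [hroot] at hA
  -- AM–GM for `1 − u`: `∏ (1 − u) ≤ ((Σ (1 − u))/m)^m = (1 − (Σ u)/m)^m`
  have hB := Real.geom_mean_le_arith_mean (Finset.univ : Finset (Fin m)) (fun _ => (1 : ℝ)) (fun a => 1 - u a)
    (fun _ _ => zero_le_one) (by simp [hmR]) (fun a _ => sub_nonneg.2 (hu1 a))
  simp only [Real.rpow_one, one_mul, Finset.sum_const, Finset.card_univ, Fintype.card_fin, nsmul_eq_mul,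
    mul_one] at hB
  have hP : (0 : ℝ) ≤ ∏ a, (1 - u a) := Finset.prod_nonneg fun a _ => sub_nonneg.2 (hu1 a)
  have hpow := pow_le_pow_left₀ (Real.rpow_nonneg hP _) hB m
  rw [Real.rpow_inv_natCast_pow hP hmpos.ne'] at hpow
  have hsum : (∑ a, (1 - u a)) / (m : ℝ) = 1 - (∑ a, u a) / m := by
    rw [Finset.sum_sub_distrib, Finset.sum_const, Finset.card_univ, Fintype.card_fin, nsmul_eq_mul, mul_one]
    field_simp
  rw [hsum] at hpow
  -- combine
  have hphi : ∏ a, phi m (n a) = ∏ a, (1 - u a) := rfl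
  rw [hphi]
  refine hpow.trans (pow_le_pow_left₀ ?_ (by linarith) m)
  have : (∑ a, u a) / (m : ℝ) ≤ 1 := by
    rw [div_le_one hmR]
    calc ∑ a, u a ≤ ∑ _a : Fin m, (1 : ℝ) := Finset.sum_le_sum fun a _ => hu1 a
      _ = m := by simp
  linarith

/-! ## 2. Stars at a fixed host are column covers through shared cells -/

/-- The cells block `b` shares with host `d` (none, by convention, for `b = d`). [this file] -/
def hostCells (d b : Fin 3 → Fin (qOf m)) : Finset (Fin m × Fin m) := by
  classical
  exact if b = d then ∅ else Finset.univ.filter fun x : Fin m × Fin m => cellEmb m b x = cellEmb m d x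

/-- `|hostCells d b| ≤ 2`. [this file] -/
theorem card_hostCells_le (d b : Fin 3 → Fin (qOf m)) : (hostCells d b).card ≤ 2 := by
  classical
  unfold hostCells
  split_ifs with h
  · simp
  · exact card_sharedPos_le_two h

/-- `Σ_a Σ_{b ∈ S} #(hostCells d b ∩ column a) ≤ 2|S|`. [this file] -/
theorem sum_colCount_hostCells_le (d : Fin 3 → Fin (qOf m)) (S : Finset (Fin 3 → Fin (qOf m))) :
    ∑ a, ∑ b ∈ S, colCount (hostCells d b) a ≤ 2 * S.card := by
  rw [Finset.sum_comm]
  calc ∑ b ∈ S, ∑ a, colCount (hostCells d b) a = ∑ b ∈ S, (hostCells d b).card :=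
        Finset.sum_congr rfl fun b _ => sum_colCount _
    _ ≤ ∑ _b ∈ S, 2 := Finset.sum_le_sum fun b _ => card_hostCells_le d b
    _ = 2 * S.card := by rw [Finset.sum_const, smul_eq_mul, mul_comm]

/-- **Refined first moment.** For `m ≥ 3`: if `q(m)³ · (1 − c^{2|supp κ₀|/m})^m < 1` then some choice of one
pattern per block is star-free for `κ₀`. [this file] -/
theorem exists_starFree_refined (hm : 3 ≤ m) (κ₀ : (Fin 3 → Fin (qOf m)) →₀ ℕ)
    (hcount : (qOf m : ℝ) ^ 3 * coinBound m (2 * κ₀.support.card) < 1) :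
    ∃ π : (Fin 3 → Fin (qOf m)) → Equiv.Perm (Fin m), ∀ d : Fin 3 → Fin (qOf m), ∃ a : Fin m,
      ∀ b : Fin 3 → Fin (qOf m), b ≠ d → κ₀ b ≠ 0 → cellEmb m b (π b a, a) ≠ cellEmb m d (π b a, a) := by
  classical
  set S := κ₀.support with hS
  set Bad : Finset ((Fin 3 → Fin (qOf m)) → Equiv.Perm (Fin m)) := Finset.univ.filter fun π =>
    ∃ d, ∀ a, ∃ b, b ≠ d ∧ κ₀ b ≠ 0 ∧ cellEmb m b (π b a, a) = cellEmb m d (π b a, a) with hBad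
  set Cov : (Fin 3 → Fin (qOf m)) → Finset ((Fin 3 → Fin (qOf m)) → Equiv.Perm (Fin m)) := fun d =>
    Finset.univ.filter fun π => ∀ a ∈ (Finset.univ : Finset (Fin m)), ∃ b ∈ S, (π b a, a) ∈ hostCells d b with hCov
  have hcover : Bad ⊆ Finset.univ.biUnion Cov := by
    intro π hπ
    obtain ⟨d, hd⟩ := (Finset.mem_filter.1 hπ).2
    refine Finset.mem_biUnion.2 ⟨d, Finset.mem_univ _, Finset.mem_filter.2 ⟨Finset.mem_univ _, fun a _ => ?_⟩⟩
    obtain ⟨b, hbd, hb0, hcell⟩ := hd a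
    refine ⟨b, Finsupp.mem_support_iff.2 hb0, ?_⟩
    simp only [hostCells, if_neg hbd]
    exact Finset.mem_filter.2 ⟨Finset.mem_univ _, hcell⟩
  have hq : Fintype.card (Fin 3 → Fin (qOf m)) = qOf m ^ 3 := by
    rw [Fintype.card_fun, Fintype.card_fin, Fintype.card_fin]
  set F : ℝ := (Nat.factorial m : ℝ) with hF
  have hF0 : 0 < F := by rw [hF]; exact_mod_cast Nat.factorial_pos m
  -- per host
  have hCov : ∀ d, ((Cov d).card : ℝ) ≤ F ^ (qOf m ^ 3) * coinBound m (2 * S.card) := by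
    intro d
    have h := cover_count hm (hostCells d) (card_hostCells_le d) S (Finset.univ : Finset (Fin m))
    rw [hq] at h
    refine h.trans (mul_le_mul_of_nonneg_left ?_ (pow_nonneg hF0.le _))
    exact (prod_phi_le hm _).trans (coinBound_mono hm (sum_colCount_hostCells_le d S))
  -- union bound
  have hBadle : (Bad.card : ℝ) ≤ (qOf m : ℝ) ^ 3 * (F ^ (qOf m ^ 3) * coinBound m (2 * S.card)) := by
    calc (Bad.card : ℝ) ≤ ((Finset.univ.biUnion Cov).card : ℝ) := by exact_mod_cast Finset.card_le_card hcover
      _ ≤ ∑ d, ((Cov d).card : ℝ) := by exact_mod_cast Finset.card_biUnion_le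
      _ ≤ ∑ _d : Fin 3 → Fin (qOf m), F ^ (qOf m ^ 3) * coinBound m (2 * S.card) := Finset.sum_le_sum fun d _ => hCov d
      _ = _ := by rw [Finset.sum_const, Finset.card_univ, hq, nsmul_eq_mul]; push_cast; ring
  have hlt : (Bad.card : ℝ) < F ^ (qOf m ^ 3) := by
    calc (Bad.card : ℝ) ≤ F ^ (qOf m ^ 3) * ((qOf m : ℝ) ^ 3 * coinBound m (2 * S.card)) := by
          rw [mul_left_comm] at hBadle; exact hBadle
      _ < F ^ (qOf m ^ 3) * 1 := mul_lt_mul_of_pos_left hcount (pow_pos hF0 _)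
      _ = F ^ (qOf m ^ 3) := mul_one _
  have hΩ : (Fintype.card ((Fin 3 → Fin (qOf m)) → Equiv.Perm (Fin m)) : ℝ) = F ^ (qOf m ^ 3) := by
    rw [Fintype.card_fun, Fintype.card_perm, Fintype.card_fin, hq]; push_cast; rw [hF]
  have hBadlt : Bad.card < Fintype.card ((Fin 3 → Fin (qOf m)) → Equiv.Perm (Fin m)) := by
    have : (Bad.card : ℝ) < Fintype.card ((Fin 3 → Fin (qOf m)) → Equiv.Perm (Fin m)) := by rw [hΩ]; exact hlt
    exact_mod_cast this
  have hne : Badᶜ.Nonempty := by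
    rw [← Finset.card_pos, Finset.card_compl]
    omega
  obtain ⟨π, hπ⟩ := hne
  rw [Finset.mem_compl, hBad, Finset.mem_filter, not_and] at hπ
  have hπ' := hπ (Finset.mem_univ _)
  push Not at hπ'
  refine ⟨π, fun d => ?_⟩
  obtain ⟨a, ha⟩ := hπ' d
  exact ⟨a, fun b hbd hb0 hcell => ha b hbd hb0 hcell⟩

/-! ## 3. Theorem A⁺ -/

/-- **Theorem A⁺ (refined random witness patterns).** For `m ≥ 3` and `c = (m−2)/(m−1)`: if
`q(m)³ · (1 − c^{2t/m})^m < 1` then every nonzero `D` of total degree `≤ t` — of any size — satisfies `D ∘ G_m ≠ 0`.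
[this file] -/
theorem kiPer_hits_of_refined (hm : 3 ≤ m) {t : ℕ} (hcount : (qOf m : ℝ) ^ 3 * coinBound m (2 * t) < 1)
    (D : MvPolynomial (Fin 3 → Fin (qOf m)) ℂ) (hD : D ≠ 0) (hdeg : D.totalDegree ≤ t) :
    MvPolynomial.bind₁ (kiPer m) D ≠ 0 := by
  classical
  obtain ⟨κ₀, hκ₀⟩ := Finset.nonempty_iff_ne_empty.2 (mt MvPolynomial.support_eq_empty.1 hD)
  have hs : κ₀.support.card ≤ t := (card_support_le_totalDegree hκ₀).trans hdeg
  have hcount' : (qOf m : ℝ) ^ 3 * coinBound m (2 * κ₀.support.card) < 1 :=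
    lt_of_le_of_lt (mul_le_mul_of_nonneg_left (coinBound_mono hm (Nat.mul_le_mul_left 2 hs)) (by positivity))
      hcount
  obtain ⟨π, hπ⟩ := exists_starFree_refined hm κ₀ hcount'
  exact kiPer_hits_of_starFree D hκ₀ hπ

/-- Pointwise form: an annihilator of `G_m` has total degree `> t` whenever `q(m)³ (1 − c^{2t/m})^m < 1`. [this file] -/
theorem totalDegree_gt_of_annihilator_refined (hm : 3 ≤ m) {t : ℕ}
    (hcount : (qOf m : ℝ) ^ 3 * coinBound m (2 * t) < 1) {D : MvPolynomial (Fin 3 → Fin (qOf m)) ℂ} (hD : D ≠ 0)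
    (hann : MvPolynomial.bind₁ (kiPer m) D = 0) : t < D.totalDegree := by
  by_contra h
  exact kiPer_hits_of_refined hm hcount D hD (not_lt.1 h) hann

end Summit.ValiantsHypothesis.ValiantsHypothesis.Theorems.DefinabilityGapRefinedPatterns
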